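import Mathlib
import HarnessLib

/-!
# Far-side channel estimate: the data-side inequality at fixed cut-off

Analysis/PDE support file (everything proved, no definitions; real analysis only). At a fixed far
edge `ρ ≥ 1` let `(f,g)` be Cauchy data, `(f_X,g_X)` their cut-off (tail `V`-energy `≤ T`), and
`k = (Σ_k a_k ι^{ℓ−2k}, Σ_k b_k ι^{ℓ−2k})` an exact datum with
`∫_ρ^X [((f_X − kpos)')² + ℓ(ℓ+1)ι²(f_X−kpos)² + (g_X − kvel)²] ≤ S` for all `X` (the exact channel
inequality), let the exact energy of `(f_X,g_X)` on `(ρ,∞)` be `≤ E₀`, and let `(tpos,tvel)` be the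
data of a true kernel element whose `V`-distance to `k` on `(ρ,∞)` is `≤ (Kf/ρ)·(exact energy of k)`
(the transfer inequality). If `V ≤ 2ℓ(ℓ+1)ι²` on `[ρ,∞)` then (`farStep_data`)

  `∫_{x>ρ} (g − tvel)² + ((f − tpos)')² + V(f − tpos)² ≤ 3T + 6S + 3(Kf/ρ)(2S + 2E₀)`.

Route PhotonSphereChannels, `FixedModeChannels`, far side (stmt-FinalStateConjecture-10048): the
data distance of `ψ − q` (`q` a true kernel element) is controlled by the exact channel energies,
the tail and terms carrying `1/ρ`. Folklore.
-/

noncomputable section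

namespace Literature.Analysis.PDE

open MeasureTheory Set Filter Topology Finset

/-- `(x+y+z)² ≤ 3x² + 3y² + 3z²`. [folklore] -/
theorem sq_add_three_le (x y z : ℝ) : (x + y + z) ^ 2 ≤ 3 * x ^ 2 + 3 * y ^ 2 + 3 * z ^ 2 := by
  nlinarith [sq_nonneg (x - y), sq_nonneg (y - z), sq_nonneg (x - z)]

/-- A non-negative continuous function with bounded integrals on `[ρ, X]` is integrable on `(ρ,∞)`
with integral at most the bound. [folklore] -/
theorem integrableOn_Ioi_of_intervalIntegral_le' {φ : ℝ → ℝ} (hφ : Continuous φ) {ρ : ℝ}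
    (hφ0 : ∀ x, ρ < x → 0 ≤ φ x) {S : ℝ} (hS : ∀ X, ρ ≤ X → (∫ x in ρ..X, φ x) ≤ S) :
    IntegrableOn φ (Ioi ρ) ∧ (∫ x in Ioi ρ, φ x) ≤ S := by
  have hint : IntegrableOn φ (Ioi ρ) := by
    refine integrableOn_Ioi_of_intervalIntegral_norm_bounded (μ := volume) (l := atTop)
      (b := fun Y : ℝ => Y) S ρ (fun Y => (hφ.integrableOn_Icc).mono_set Ioc_subset_Icc_self)
      tendsto_id ?_
    filter_upwards [eventually_ge_atTop ρ] with Y hY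
    calc (∫ x in ρ..Y, ‖φ x‖) = ∫ x in ρ..Y, φ x := by
          refine intervalIntegral.integral_congr_ae ?_
          rw [uIoc_of_le hY]
          exact ae_of_all _ fun x hx => by
            simp only [Real.norm_eq_abs, abs_of_nonneg (hφ0 x hx.1)]
      _ ≤ S := hS Y hY
  refine ⟨hint, le_of_tendsto (intervalIntegral_tendsto_integral_Ioi ρ hint tendsto_id) ?_⟩
  filter_upwards [eventually_ge_atTop ρ] with Y hY
  exact hS Y hY

variable {V ι : ℝ → ℝ} {ℓ : ℕ} {ρ : ℝ} {f g fX gX tpos tvel : ℝ → ℝ} {a b : ℕ → ℝ}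
  {T E₀ S Kf : ℝ}

/-- **The data-side inequality of the far channel estimate.** See the module docstring.
[folklore] -/
theorem farStep_data (hV : Continuous V) (hV0 : ∀ x, 0 ≤ V x) (hι : ContDiff ℝ (⊤ : ℕ∞) ι)
    (hρ0 : 0 < ρ)
    (hV3 : ∀ x, ρ ≤ x → V x ≤ 2 * ((ℓ : ℝ) * (ℓ + 1) * ι x ^ 2))
    (hf : ContDiff ℝ 2 f) (hg : ContDiff ℝ 1 g) (hfX : ContDiff ℝ 2 fX) (hgX : ContDiff ℝ 1 gX)
    (htpos : ContDiff ℝ 1 tpos) (htvel : Continuous tvel)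
    (htail : IntegrableOn (fun x => ((g x - gX x) ^ 2 + deriv (fun y => f y - fX y) x ^ 2 + V x * (f x - fX x) ^ 2)) (Ioi ρ) ∧
      ∫ x in Ioi ρ, ((g x - gX x) ^ 2 + deriv (fun y => f y - fX y) x ^ 2 + V x * (f x - fX x) ^ 2) ≤ T)
    (hE₀ : IntegrableOn (fun x => (gX x ^ 2 + deriv fX x ^ 2 + ℓ * (ℓ + 1) * ι x ^ 2 * fX x ^ 2)) (Ioi ρ) ∧
      ∫ x in Ioi ρ, (gX x ^ 2 + deriv fX x ^ 2 + ℓ * (ℓ + 1) * ι x ^ 2 * fX x ^ 2) ≤ E₀)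
    (hA2 : ∀ X, ρ ≤ X → ∫ x in ρ..X, (deriv (fun y => fX y - ∑ k ∈ range (ℓ / 2 + 1), a k * ι y ^ (ℓ - 2 * k)) x ^ 2
        + ℓ * (ℓ + 1) * ι x ^ 2 * (fX x - ∑ k ∈ range (ℓ / 2 + 1), a k * ι x ^ (ℓ - 2 * k)) ^ 2 + (gX x - ∑ k ∈ range ((ℓ + 1) / 2), b k * ι x ^ (ℓ - 2 * k)) ^ 2) ≤ S)
    (hKf0 : 0 ≤ Kf)
    (hKf : IntegrableOn (fun x => ((∑ k ∈ range ((ℓ + 1) / 2), b k * ι x ^ (ℓ - 2 * k)) ^ 2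
        + deriv (fun y => ∑ k ∈ range (ℓ / 2 + 1), a k * ι y ^ (ℓ - 2 * k)) x ^ 2 + ℓ * (ℓ + 1) * ι x ^ 2 * (∑ k ∈ range (ℓ / 2 + 1), a k * ι x ^ (ℓ - 2 * k)) ^ 2)) (Ioi ρ) →
      IntegrableOn (fun x => ((tvel x - ∑ k ∈ range ((ℓ + 1) / 2), b k * ι x ^ (ℓ - 2 * k)) ^ 2
        + deriv (fun y => tpos y - ∑ k ∈ range (ℓ / 2 + 1), a k * ι y ^ (ℓ - 2 * k)) x ^ 2 + V x * (tpos x - ∑ k ∈ range (ℓ / 2 + 1), a k * ι x ^ (ℓ - 2 * k)) ^ 2)) (Ioi ρ) ∧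
      ∫ x in Ioi ρ, ((tvel x - ∑ k ∈ range ((ℓ + 1) / 2), b k * ι x ^ (ℓ - 2 * k)) ^ 2
        + deriv (fun y => tpos y - ∑ k ∈ range (ℓ / 2 + 1), a k * ι y ^ (ℓ - 2 * k)) x ^ 2 + V x * (tpos x - ∑ k ∈ range (ℓ / 2 + 1), a k * ι x ^ (ℓ - 2 * k)) ^ 2)
        ≤ Kf / ρ * ∫ x in Ioi ρ, ((∑ k ∈ range ((ℓ + 1) / 2), b k * ι x ^ (ℓ - 2 * k)) ^ 2
        + deriv (fun y => ∑ k ∈ range (ℓ / 2 + 1), a k * ι y ^ (ℓ - 2 * k)) x ^ 2 + ℓ * (ℓ + 1) * ι x ^ 2 * (∑ k ∈ range (ℓ / 2 + 1), a k * ι x ^ (ℓ - 2 * k)) ^ 2)) :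
    IntegrableOn (fun x => ((g x - tvel x) ^ 2 + deriv (fun y => f y - tpos y) x ^ 2 + V x * (f x - tpos x) ^ 2)) (Ioi ρ) ∧
    ∫ x in Ioi ρ, ((g x - tvel x) ^ 2 + deriv (fun y => f y - tpos y) x ^ 2 + V x * (f x - tpos x) ^ 2) ≤ 3 * T + 6 * S + 3 * (Kf / ρ * (2 * S + 2 * E₀)) := by
  -- smoothness of the exact datum
  have hkposC : ContDiff ℝ 2 fun y => ∑ k ∈ range (ℓ / 2 + 1), a k * ι y ^ (ℓ - 2 * k) := by
    have h : ∀ m : ℕ, ContDiff ℝ m fun y => ∑ k ∈ range (ℓ / 2 + 1), a k * ι y ^ (ℓ - 2 * k) :=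
      fun m => ContDiff.sum fun k _ => (contDiff_const.mul (hι.pow _)).of_le (by exact_mod_cast le_top)
    exact h 2
  have hkvelc : Continuous fun x => ∑ k ∈ range ((ℓ + 1) / 2), b k * ι x ^ (ℓ - 2 * k) :=
    continuous_finsetSum _ fun k _ => continuous_const.mul (hι.continuous.pow _)
  have hιc : Continuous ι := hι.continuous
  have hdiff : ∀ (u : ℝ → ℝ), ContDiff ℝ 2 u → ∀ x, DifferentiableAt ℝ u x := fun u hu x =>
    (hu.differentiable (by norm_num)) x
  have hdc : ∀ (u : ℝ → ℝ), ContDiff ℝ 2 u → Continuous (deriv u) := fun u hu =>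
    hu.continuous_deriv (by norm_num)
  have htposd : ∀ x, DifferentiableAt ℝ tpos x := fun x => (htpos.differentiable (by norm_num)) x
  -- (1) the exact channel integrand: integrable with integral `≤ S`
  have hA2c : Continuous fun x => (deriv (fun y => fX y - ∑ k ∈ range (ℓ / 2 + 1), a k * ι y ^ (ℓ - 2 * k)) x ^ 2
        + ℓ * (ℓ + 1) * ι x ^ 2 * (fX x - ∑ k ∈ range (ℓ / 2 + 1), a k * ι x ^ (ℓ - 2 * k)) ^ 2 + (gX x - ∑ k ∈ range ((ℓ + 1) / 2), b k * ι x ^ (ℓ - 2 * k)) ^ 2) := by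
    refine ((hdc _ (hfX.sub hkposC)).pow 2 |>.add ?_).add ((hgX.continuous.sub hkvelc).pow 2)
    exact ((continuous_const.mul (hιc.pow 2)).mul ((hfX.continuous.sub hkposC.continuous).pow 2))
  have hA2nn : ∀ x, 0 ≤ (deriv (fun y => fX y - ∑ k ∈ range (ℓ / 2 + 1), a k * ι y ^ (ℓ - 2 * k)) x ^ 2
        + ℓ * (ℓ + 1) * ι x ^ 2 * (fX x - ∑ k ∈ range (ℓ / 2 + 1), a k * ι x ^ (ℓ - 2 * k)) ^ 2 + (gX x - ∑ k ∈ range ((ℓ + 1) / 2), b k * ι x ^ (ℓ - 2 * k)) ^ 2) := fun x => by positivity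
  obtain ⟨hA2i, hA2le⟩ := integrableOn_Ioi_of_intervalIntegral_le' hA2c (fun x _ => hA2nn x) hA2
  have hS0 : 0 ≤ S := le_trans (setIntegral_nonneg measurableSet_Ioi fun x _ => hA2nn x) hA2le
  have hE₀0 : 0 ≤ E₀ := le_trans (setIntegral_nonneg measurableSet_Ioi fun x _ => by positivity) hE₀.2
  -- (2) the exact energy of `k`: `kex ≤ 2·A2 + 2·eex` pointwise
  have hkexc : Continuous fun x => ((∑ k ∈ range ((ℓ + 1) / 2), b k * ι x ^ (ℓ - 2 * k)) ^ 2
        + deriv (fun y => ∑ k ∈ range (ℓ / 2 + 1), a k * ι y ^ (ℓ - 2 * k)) x ^ 2 + ℓ * (ℓ + 1) * ι x ^ 2 * (∑ k ∈ range (ℓ / 2 + 1), a k * ι x ^ (ℓ - 2 * k)) ^ 2) :=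
    ((hkvelc.pow 2).add ((hdc _ hkposC).pow 2)).add
      ((continuous_const.mul (hιc.pow 2)).mul (hkposC.continuous.pow 2))
  have hkex_pt : ∀ x, ((∑ k ∈ range ((ℓ + 1) / 2), b k * ι x ^ (ℓ - 2 * k)) ^ 2
        + deriv (fun y => ∑ k ∈ range (ℓ / 2 + 1), a k * ι y ^ (ℓ - 2 * k)) x ^ 2 + ℓ * (ℓ + 1) * ι x ^ 2 * (∑ k ∈ range (ℓ / 2 + 1), a k * ι x ^ (ℓ - 2 * k)) ^ 2)
      ≤ 2 * (deriv (fun y => fX y - ∑ k ∈ range (ℓ / 2 + 1), a k * ι y ^ (ℓ - 2 * k)) x ^ 2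
        + ℓ * (ℓ + 1) * ι x ^ 2 * (fX x - ∑ k ∈ range (ℓ / 2 + 1), a k * ι x ^ (ℓ - 2 * k)) ^ 2 + (gX x - ∑ k ∈ range ((ℓ + 1) / 2), b k * ι x ^ (ℓ - 2 * k)) ^ 2)
        + 2 * (gX x ^ 2 + deriv fX x ^ 2 + ℓ * (ℓ + 1) * ι x ^ 2 * fX x ^ 2) := by
    intro x
    have e1 : deriv (fun y => fX y - ∑ k ∈ range (ℓ / 2 + 1), a k * ι y ^ (ℓ - 2 * k)) x
        = deriv fX x - deriv (fun y => ∑ k ∈ range (ℓ / 2 + 1), a k * ι y ^ (ℓ - 2 * k)) x :=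
      deriv_fun_sub (hdiff _ hfX x) (hdiff _ hkposC x)
    rw [e1]
    have h0 : 0 ≤ (ℓ : ℝ) * (ℓ + 1) * ι x ^ 2 := by positivity
    have h1 : (∑ k ∈ range ((ℓ + 1) / 2), b k * ι x ^ (ℓ - 2 * k)) ^ 2
        ≤ 2 * (gX x - ∑ k ∈ range ((ℓ + 1) / 2), b k * ι x ^ (ℓ - 2 * k)) ^ 2 + 2 * gX x ^ 2 := by
      have := sq_nonneg (2 * gX x - ∑ k ∈ range ((ℓ + 1) / 2), b k * ι x ^ (ℓ - 2 * k)); linarith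
    have h2 : deriv (fun y => ∑ k ∈ range (ℓ / 2 + 1), a k * ι y ^ (ℓ - 2 * k)) x ^ 2
        ≤ 2 * (deriv fX x - deriv (fun y => ∑ k ∈ range (ℓ / 2 + 1), a k * ι y ^ (ℓ - 2 * k)) x) ^ 2 + 2 * deriv fX x ^ 2 := by
      have := sq_nonneg (2 * deriv fX x - deriv (fun y => ∑ k ∈ range (ℓ / 2 + 1), a k * ι y ^ (ℓ - 2 * k)) x); linarith
    have h3 : (∑ k ∈ range (ℓ / 2 + 1), a k * ι x ^ (ℓ - 2 * k)) ^ 2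
        ≤ 2 * (fX x - ∑ k ∈ range (ℓ / 2 + 1), a k * ι x ^ (ℓ - 2 * k)) ^ 2 + 2 * fX x ^ 2 := by
      have := sq_nonneg (2 * fX x - ∑ k ∈ range (ℓ / 2 + 1), a k * ι x ^ (ℓ - 2 * k)); linarith
    have h4 := mul_le_mul_of_nonneg_left h3 h0
    linarith [h1, h2, h4]
  have hkexi : IntegrableOn (fun x => ((∑ k ∈ range ((ℓ + 1) / 2), b k * ι x ^ (ℓ - 2 * k)) ^ 2
        + deriv (fun y => ∑ k ∈ range (ℓ / 2 + 1), a k * ι y ^ (ℓ - 2 * k)) x ^ 2 + ℓ * (ℓ + 1) * ι x ^ 2 * (∑ k ∈ range (ℓ / 2 + 1), a k * ι x ^ (ℓ - 2 * k)) ^ 2)) (Ioi ρ) :=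
    Integrable.mono' ((hA2i.const_mul 2).add (hE₀.1.const_mul 2)) hkexc.aestronglyMeasurable
      (ae_of_all _ fun x => by
        rw [Real.norm_eq_abs, abs_of_nonneg (by positivity)]
        exact hkex_pt x)
  have hkexle : ∫ x in Ioi ρ, ((∑ k ∈ range ((ℓ + 1) / 2), b k * ι x ^ (ℓ - 2 * k)) ^ 2
        + deriv (fun y => ∑ k ∈ range (ℓ / 2 + 1), a k * ι y ^ (ℓ - 2 * k)) x ^ 2 + ℓ * (ℓ + 1) * ι x ^ 2 * (∑ k ∈ range (ℓ / 2 + 1), a k * ι x ^ (ℓ - 2 * k)) ^ 2) ≤ 2 * S + 2 * E₀ := by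
    calc ∫ x in Ioi ρ, ((∑ k ∈ range ((ℓ + 1) / 2), b k * ι x ^ (ℓ - 2 * k)) ^ 2
        + deriv (fun y => ∑ k ∈ range (ℓ / 2 + 1), a k * ι y ^ (ℓ - 2 * k)) x ^ 2 + ℓ * (ℓ + 1) * ι x ^ 2 * (∑ k ∈ range (ℓ / 2 + 1), a k * ι x ^ (ℓ - 2 * k)) ^ 2)
        ≤ ∫ x in Ioi ρ, (2 * (deriv (fun y => fX y - ∑ k ∈ range (ℓ / 2 + 1), a k * ι y ^ (ℓ - 2 * k)) x ^ 2
        + ℓ * (ℓ + 1) * ι x ^ 2 * (fX x - ∑ k ∈ range (ℓ / 2 + 1), a k * ι x ^ (ℓ - 2 * k)) ^ 2 + (gX x - ∑ k ∈ range ((ℓ + 1) / 2), b k * ι x ^ (ℓ - 2 * k)) ^ 2)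
          + 2 * (gX x ^ 2 + deriv fX x ^ 2 + ℓ * (ℓ + 1) * ι x ^ 2 * fX x ^ 2)) :=
          integral_mono_of_nonneg (ae_of_all _ fun x => by positivity)
            ((hA2i.const_mul 2).add (hE₀.1.const_mul 2)) (ae_of_all _ hkex_pt)
      _ = 2 * (∫ x in Ioi ρ, (deriv (fun y => fX y - ∑ k ∈ range (ℓ / 2 + 1), a k * ι y ^ (ℓ - 2 * k)) x ^ 2
        + ℓ * (ℓ + 1) * ι x ^ 2 * (fX x - ∑ k ∈ range (ℓ / 2 + 1), a k * ι x ^ (ℓ - 2 * k)) ^ 2 + (gX x - ∑ k ∈ range ((ℓ + 1) / 2), b k * ι x ^ (ℓ - 2 * k)) ^ 2))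
          + 2 * ∫ x in Ioi ρ, (gX x ^ 2 + deriv fX x ^ 2 + ℓ * (ℓ + 1) * ι x ^ 2 * fX x ^ 2) := by
          rw [integral_add (hA2i.const_mul 2) (hE₀.1.const_mul 2), integral_const_mul,
            integral_const_mul]
      _ ≤ 2 * S + 2 * E₀ := by linarith [hA2le, hE₀.2]
  -- (3) the transfer term
  obtain ⟨hdisti, hdistle⟩ := hKf hkexi
  have hdistle' : ∫ x in Ioi ρ, ((tvel x - ∑ k ∈ range ((ℓ + 1) / 2), b k * ι x ^ (ℓ - 2 * k)) ^ 2
        + deriv (fun y => tpos y - ∑ k ∈ range (ℓ / 2 + 1), a k * ι y ^ (ℓ - 2 * k)) x ^ 2 + V x * (tpos x - ∑ k ∈ range (ℓ / 2 + 1), a k * ι x ^ (ℓ - 2 * k)) ^ 2) ≤ Kf / ρ * (2 * S + 2 * E₀) :=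
    hdistle.trans (mul_le_mul_of_nonneg_left hkexle (by positivity))
  -- (4) the middle term `e_V[(fX,gX) − k] ≤ 2·A2` pointwise on `(ρ,∞)`
  have hmidc : Continuous fun x => ((gX x - ∑ k ∈ range ((ℓ + 1) / 2), b k * ι x ^ (ℓ - 2 * k)) ^ 2
        + deriv (fun y => fX y - ∑ k ∈ range (ℓ / 2 + 1), a k * ι y ^ (ℓ - 2 * k)) x ^ 2 + V x * (fX x - ∑ k ∈ range (ℓ / 2 + 1), a k * ι x ^ (ℓ - 2 * k)) ^ 2) :=
    (((hgX.continuous.sub hkvelc).pow 2).add ((hdc _ (hfX.sub hkposC)).pow 2)).add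
      (hV.mul ((hfX.continuous.sub hkposC.continuous).pow 2))
  have hmid_pt : ∀ x ∈ Ioi ρ, ((gX x - ∑ k ∈ range ((ℓ + 1) / 2), b k * ι x ^ (ℓ - 2 * k)) ^ 2
        + deriv (fun y => fX y - ∑ k ∈ range (ℓ / 2 + 1), a k * ι y ^ (ℓ - 2 * k)) x ^ 2 + V x * (fX x - ∑ k ∈ range (ℓ / 2 + 1), a k * ι x ^ (ℓ - 2 * k)) ^ 2)
      ≤ 2 * (deriv (fun y => fX y - ∑ k ∈ range (ℓ / 2 + 1), a k * ι y ^ (ℓ - 2 * k)) x ^ 2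
        + ℓ * (ℓ + 1) * ι x ^ 2 * (fX x - ∑ k ∈ range (ℓ / 2 + 1), a k * ι x ^ (ℓ - 2 * k)) ^ 2 + (gX x - ∑ k ∈ range ((ℓ + 1) / 2), b k * ι x ^ (ℓ - 2 * k)) ^ 2) := by
    intro x hx
    have h3 := hV3 x (le_of_lt hx)
    have hVx := hV0 x
    have h0 : 0 ≤ (fX x - ∑ k ∈ range (ℓ / 2 + 1), a k * ι x ^ (ℓ - 2 * k)) ^ 2 := sq_nonneg _
    linarith [mul_le_mul_of_nonneg_right h3 h0,
      sq_nonneg (deriv (fun y => fX y - ∑ k ∈ range (ℓ / 2 + 1), a k * ι y ^ (ℓ - 2 * k)) x), sq_nonneg (gX x - ∑ k ∈ range ((ℓ + 1) / 2), b k * ι x ^ (ℓ - 2 * k))]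
  have hmidi : IntegrableOn (fun x => ((gX x - ∑ k ∈ range ((ℓ + 1) / 2), b k * ι x ^ (ℓ - 2 * k)) ^ 2
        + deriv (fun y => fX y - ∑ k ∈ range (ℓ / 2 + 1), a k * ι y ^ (ℓ - 2 * k)) x ^ 2 + V x * (fX x - ∑ k ∈ range (ℓ / 2 + 1), a k * ι x ^ (ℓ - 2 * k)) ^ 2)) (Ioi ρ) :=
    Integrable.mono' (hA2i.const_mul 2) hmidc.aestronglyMeasurable
      ((ae_restrict_iff' measurableSet_Ioi).2 (ae_of_all _ fun x hx => by
        rw [Real.norm_eq_abs, abs_of_nonneg (by have := hV0 x; positivity)]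
        exact hmid_pt x hx))
  have hmidle : ∫ x in Ioi ρ, ((gX x - ∑ k ∈ range ((ℓ + 1) / 2), b k * ι x ^ (ℓ - 2 * k)) ^ 2
        + deriv (fun y => fX y - ∑ k ∈ range (ℓ / 2 + 1), a k * ι y ^ (ℓ - 2 * k)) x ^ 2 + V x * (fX x - ∑ k ∈ range (ℓ / 2 + 1), a k * ι x ^ (ℓ - 2 * k)) ^ 2) ≤ 2 * S := by
    calc ∫ x in Ioi ρ, ((gX x - ∑ k ∈ range ((ℓ + 1) / 2), b k * ι x ^ (ℓ - 2 * k)) ^ 2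
        + deriv (fun y => fX y - ∑ k ∈ range (ℓ / 2 + 1), a k * ι y ^ (ℓ - 2 * k)) x ^ 2 + V x * (fX x - ∑ k ∈ range (ℓ / 2 + 1), a k * ι x ^ (ℓ - 2 * k)) ^ 2)
        ≤ ∫ x in Ioi ρ, 2 * (deriv (fun y => fX y - ∑ k ∈ range (ℓ / 2 + 1), a k * ι y ^ (ℓ - 2 * k)) x ^ 2
        + ℓ * (ℓ + 1) * ι x ^ 2 * (fX x - ∑ k ∈ range (ℓ / 2 + 1), a k * ι x ^ (ℓ - 2 * k)) ^ 2 + (gX x - ∑ k ∈ range ((ℓ + 1) / 2), b k * ι x ^ (ℓ - 2 * k)) ^ 2) :=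
          setIntegral_mono_on hmidi (hA2i.const_mul 2) measurableSet_Ioi hmid_pt
      _ = 2 * ∫ x in Ioi ρ, (deriv (fun y => fX y - ∑ k ∈ range (ℓ / 2 + 1), a k * ι y ^ (ℓ - 2 * k)) x ^ 2
        + ℓ * (ℓ + 1) * ι x ^ 2 * (fX x - ∑ k ∈ range (ℓ / 2 + 1), a k * ι x ^ (ℓ - 2 * k)) ^ 2 + (gX x - ∑ k ∈ range ((ℓ + 1) / 2), b k * ι x ^ (ℓ - 2 * k)) ^ 2) := integral_const_mul _ _
      _ ≤ 2 * S := by linarith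
  -- (5) the final integrand `≤ 3·tail + 3·mid + 3·dist` pointwise
  have hftpos : ContDiff ℝ 1 (fun y => f y - tpos y) := (hf.of_le (by norm_num)).sub htpos
  have hfinc : Continuous fun x => ((g x - tvel x) ^ 2 + deriv (fun y => f y - tpos y) x ^ 2 + V x * (f x - tpos x) ^ 2) :=
    (((hg.continuous.sub htvel).pow 2).add ((hftpos.continuous_deriv le_rfl).pow 2)).add
      (hV.mul ((hf.continuous.sub htpos.continuous).pow 2))
  have hfin_pt : ∀ x, ((g x - tvel x) ^ 2 + deriv (fun y => f y - tpos y) x ^ 2 + V x * (f x - tpos x) ^ 2)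
      ≤ 3 * ((g x - gX x) ^ 2 + deriv (fun y => f y - fX y) x ^ 2 + V x * (f x - fX x) ^ 2)
        + 3 * ((gX x - ∑ k ∈ range ((ℓ + 1) / 2), b k * ι x ^ (ℓ - 2 * k)) ^ 2
        + deriv (fun y => fX y - ∑ k ∈ range (ℓ / 2 + 1), a k * ι y ^ (ℓ - 2 * k)) x ^ 2 + V x * (fX x - ∑ k ∈ range (ℓ / 2 + 1), a k * ι x ^ (ℓ - 2 * k)) ^ 2)
        + 3 * ((tvel x - ∑ k ∈ range ((ℓ + 1) / 2), b k * ι x ^ (ℓ - 2 * k)) ^ 2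
        + deriv (fun y => tpos y - ∑ k ∈ range (ℓ / 2 + 1), a k * ι y ^ (ℓ - 2 * k)) x ^ 2 + V x * (tpos x - ∑ k ∈ range (ℓ / 2 + 1), a k * ι x ^ (ℓ - 2 * k)) ^ 2) := by
    intro x
    have d1 : deriv (fun y => f y - tpos y) x = deriv f x - deriv tpos x :=
      deriv_fun_sub (hdiff _ hf x) (htposd x)
    have d2 : deriv (fun y => f y - fX y) x = deriv f x - deriv fX x :=
      deriv_fun_sub (hdiff _ hf x) (hdiff _ hfX x)
    have d3 : deriv (fun y => fX y - ∑ k ∈ range (ℓ / 2 + 1), a k * ι y ^ (ℓ - 2 * k)) x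
        = deriv fX x - deriv (fun y => ∑ k ∈ range (ℓ / 2 + 1), a k * ι y ^ (ℓ - 2 * k)) x :=
      deriv_fun_sub (hdiff _ hfX x) (hdiff _ hkposC x)
    have d4 : deriv (fun y => tpos y - ∑ k ∈ range (ℓ / 2 + 1), a k * ι y ^ (ℓ - 2 * k)) x
        = deriv tpos x - deriv (fun y => ∑ k ∈ range (ℓ / 2 + 1), a k * ι y ^ (ℓ - 2 * k)) x :=
      deriv_fun_sub (htposd x) (hdiff _ hkposC x)
    rw [d1, d2, d3, d4]
    have hVx := hV0 x
    have s1 := sq_add_three_le (g x - gX x) (gX x - ∑ k ∈ range ((ℓ + 1) / 2), b k * ι x ^ (ℓ - 2 * k))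
      (∑ k ∈ range ((ℓ + 1) / 2), b k * ι x ^ (ℓ - 2 * k) - tvel x)
    have s2 := sq_add_three_le (deriv f x - deriv fX x)
      (deriv fX x - deriv (fun y => ∑ k ∈ range (ℓ / 2 + 1), a k * ι y ^ (ℓ - 2 * k)) x)
      (deriv (fun y => ∑ k ∈ range (ℓ / 2 + 1), a k * ι y ^ (ℓ - 2 * k)) x - deriv tpos x)
    have s3 := mul_le_mul_of_nonneg_left (sq_add_three_le (f x - fX x) (fX x - ∑ k ∈ range (ℓ / 2 + 1), a k * ι x ^ (ℓ - 2 * k))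
      (∑ k ∈ range (ℓ / 2 + 1), a k * ι x ^ (ℓ - 2 * k) - tpos x)) hVx
    have e1 : g x - tvel x = (g x - gX x) + (gX x - ∑ k ∈ range ((ℓ + 1) / 2), b k * ι x ^ (ℓ - 2 * k))
        + (∑ k ∈ range ((ℓ + 1) / 2), b k * ι x ^ (ℓ - 2 * k) - tvel x) := by ring
    have e2 : deriv f x - deriv tpos x = (deriv f x - deriv fX x)
        + (deriv fX x - deriv (fun y => ∑ k ∈ range (ℓ / 2 + 1), a k * ι y ^ (ℓ - 2 * k)) x)
        + (deriv (fun y => ∑ k ∈ range (ℓ / 2 + 1), a k * ι y ^ (ℓ - 2 * k)) x - deriv tpos x) := by ring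
    have e3 : f x - tpos x = (f x - fX x) + (fX x - ∑ k ∈ range (ℓ / 2 + 1), a k * ι x ^ (ℓ - 2 * k))
        + (∑ k ∈ range (ℓ / 2 + 1), a k * ι x ^ (ℓ - 2 * k) - tpos x) := by ring
    have e4 : (∑ k ∈ range ((ℓ + 1) / 2), b k * ι x ^ (ℓ - 2 * k) - tvel x) ^ 2
        = (tvel x - ∑ k ∈ range ((ℓ + 1) / 2), b k * ι x ^ (ℓ - 2 * k)) ^ 2 := by ring
    have e5 : (deriv (fun y => ∑ k ∈ range (ℓ / 2 + 1), a k * ι y ^ (ℓ - 2 * k)) x - deriv tpos x) ^ 2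
        = (deriv tpos x - deriv (fun y => ∑ k ∈ range (ℓ / 2 + 1), a k * ι y ^ (ℓ - 2 * k)) x) ^ 2 := by ring
    have e6 : (∑ k ∈ range (ℓ / 2 + 1), a k * ι x ^ (ℓ - 2 * k) - tpos x) ^ 2
        = (tpos x - ∑ k ∈ range (ℓ / 2 + 1), a k * ι x ^ (ℓ - 2 * k)) ^ 2 := by ring
    rw [e1, e2, e3]
    rw [e4] at s1
    rw [e5] at s2
    rw [e6] at s3
    refine (add_le_add (add_le_add s1 s2) s3).trans (le_of_eq ?_)
    ring
  have hmaj : IntegrableOn (fun x => 3 * ((g x - gX x) ^ 2 + deriv (fun y => f y - fX y) x ^ 2 + V x * (f x - fX x) ^ 2)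
        + 3 * ((gX x - ∑ k ∈ range ((ℓ + 1) / 2), b k * ι x ^ (ℓ - 2 * k)) ^ 2
        + deriv (fun y => fX y - ∑ k ∈ range (ℓ / 2 + 1), a k * ι y ^ (ℓ - 2 * k)) x ^ 2 + V x * (fX x - ∑ k ∈ range (ℓ / 2 + 1), a k * ι x ^ (ℓ - 2 * k)) ^ 2)
        + 3 * ((tvel x - ∑ k ∈ range ((ℓ + 1) / 2), b k * ι x ^ (ℓ - 2 * k)) ^ 2
        + deriv (fun y => tpos y - ∑ k ∈ range (ℓ / 2 + 1), a k * ι y ^ (ℓ - 2 * k)) x ^ 2 + V x * (tpos x - ∑ k ∈ range (ℓ / 2 + 1), a k * ι x ^ (ℓ - 2 * k)) ^ 2)) (Ioi ρ) :=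
    ((htail.1.const_mul 3).add (hmidi.const_mul 3)).add (hdisti.const_mul 3)
  have hfini : IntegrableOn (fun x => ((g x - tvel x) ^ 2 + deriv (fun y => f y - tpos y) x ^ 2 + V x * (f x - tpos x) ^ 2)) (Ioi ρ) :=
    Integrable.mono' hmaj hfinc.aestronglyMeasurable (ae_of_all _ fun x => by
      rw [Real.norm_eq_abs, abs_of_nonneg (by have := hV0 x; positivity)]
      exact hfin_pt x)
  refine ⟨hfini, ?_⟩
  calc ∫ x in Ioi ρ, ((g x - tvel x) ^ 2 + deriv (fun y => f y - tpos y) x ^ 2 + V x * (f x - tpos x) ^ 2)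
      ≤ ∫ x in Ioi ρ, (3 * ((g x - gX x) ^ 2 + deriv (fun y => f y - fX y) x ^ 2 + V x * (f x - fX x) ^ 2)
        + 3 * ((gX x - ∑ k ∈ range ((ℓ + 1) / 2), b k * ι x ^ (ℓ - 2 * k)) ^ 2
        + deriv (fun y => fX y - ∑ k ∈ range (ℓ / 2 + 1), a k * ι y ^ (ℓ - 2 * k)) x ^ 2 + V x * (fX x - ∑ k ∈ range (ℓ / 2 + 1), a k * ι x ^ (ℓ - 2 * k)) ^ 2)
        + 3 * ((tvel x - ∑ k ∈ range ((ℓ + 1) / 2), b k * ι x ^ (ℓ - 2 * k)) ^ 2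
        + deriv (fun y => tpos y - ∑ k ∈ range (ℓ / 2 + 1), a k * ι y ^ (ℓ - 2 * k)) x ^ 2 + V x * (tpos x - ∑ k ∈ range (ℓ / 2 + 1), a k * ι x ^ (ℓ - 2 * k)) ^ 2)) :=
        integral_mono_of_nonneg (ae_of_all _ fun x => by have := hV0 x; positivity) hmaj
          (ae_of_all _ hfin_pt)
    _ = 3 * (∫ x in Ioi ρ, ((g x - gX x) ^ 2 + deriv (fun y => f y - fX y) x ^ 2 + V x * (f x - fX x) ^ 2))
        + 3 * (∫ x in Ioi ρ, ((gX x - ∑ k ∈ range ((ℓ + 1) / 2), b k * ι x ^ (ℓ - 2 * k)) ^ 2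
        + deriv (fun y => fX y - ∑ k ∈ range (ℓ / 2 + 1), a k * ι y ^ (ℓ - 2 * k)) x ^ 2 + V x * (fX x - ∑ k ∈ range (ℓ / 2 + 1), a k * ι x ^ (ℓ - 2 * k)) ^ 2))
        + 3 * (∫ x in Ioi ρ, ((tvel x - ∑ k ∈ range ((ℓ + 1) / 2), b k * ι x ^ (ℓ - 2 * k)) ^ 2
        + deriv (fun y => tpos y - ∑ k ∈ range (ℓ / 2 + 1), a k * ι y ^ (ℓ - 2 * k)) x ^ 2 + V x * (tpos x - ∑ k ∈ range (ℓ / 2 + 1), a k * ι x ^ (ℓ - 2 * k)) ^ 2)) := by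
        rw [integral_add ((htail.1.const_mul 3).fun_add (hmidi.const_mul 3)) (hdisti.const_mul 3),
          integral_add (htail.1.const_mul 3) (hmidi.const_mul 3), integral_const_mul,
          integral_const_mul, integral_const_mul]
    _ ≤ 3 * T + 6 * S + 3 * (Kf / ρ * (2 * S + 2 * E₀)) := by
        linarith [htail.2, hmidle, hdistle']

end Literature.Analysis.PDE
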